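import Mathlib
import HarnessLib
import Summits.HubbardSuperconductivity.HubbardSuperconductivity.Theorems.KLProgrammePerturbedFermiCurveTwoFrameBand34
import Summits.HubbardSuperconductivity.HubbardSuperconductivity.Theorems.KLProgrammePerturbedFermiCurveTower

/-!
# Route `KLProgramme` — the CURVE difference of two frames: `‖Dⁱ(γ_v − γ_u)(θ)‖ ≤ 2·Σ_{k≤i} C(i,k)·|v⁽ᵏ⁾(θ) − u⁽ᵏ⁾(θ)|`, `i ≤ 4`
# (`γ_w = toLp ∘ (w • dir)` is linear in the radius), and the generic per-order size of `toLp ∘ (w • dir)`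

Cell `gate-hubbard-kl`, seat hubbard-kl-k3c3-p3 (g3; row «implicit-function / monotonicity route»).  The (E3a-MS) recipe (L)+(F) for
`stub_twoLeg_step` of the gen-5 ENGINE child (stmt-HubbardSuperconductivity-19918; k3c3-p1 MS-DESIGN-NOTE §3, GEN5-AUDIT-ANNEX row T-ms)
bounds the slot-`m` part of the scale-`n` piece through a COMPOSITE DIFFERENCE `F ∘ γ_v − F ∘ γ_u` (one increment read on the curves of two
nearby frames).  The structured chain rule (`…CompChainStruct`, p485980) then needs, besides the sizes `‖γ⁽ⁱ⁾‖`, the DIFFERENCES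
`‖γ_v⁽ⁱ⁾(θ) − γ_u⁽ⁱ⁾(θ)‖`; since `γ_w(θ) = toLp 2 (w θ • dir θ)` is LINEAR in the radius function `w`, these are the sizes of `γ_{v−u}`, i.e.
polar combinations of the radius differences `|v⁽ᵏ⁾ − u⁽ᵏ⁾|` bounded in `…TwoFrameBand(34)` (p490611, p492295).

* §1 `norm_iteratedFDeriv_toLp_smul_dir_le` (any `C⁴` radius function `w`): `|w⁽ᵏ⁾(θ)| ≤ T k` (`k ≤ 4`) ⟹
  `‖Dⁱ(toLp ∘ (w•dir))(θ)‖ ≤ 2·Σ_{k≤i} C(i,k)·T k` (Leibniz; `‖Dᵐ dir‖ ≤ 1`, `‖toLp‖ ≤ 2`); `…_four_orders` with the `deriv`-tower.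
* §2 `toLp_smul_dir_sub` (linearity in the radius), `norm_iteratedFDeriv_curve_sub_le_four_orders`:
  `‖Dⁱγ_v(θ) − Dⁱγ_u(θ)‖ ≤ 2(W₀+W₁)`, `2(W₀+2W₁+W₂)`, `2(W₀+3W₁+3W₂+W₃)`, `2(W₀+4W₁+6W₂+4W₃+W₄)` from `|v⁽ᵏ⁾ − u⁽ᵏ⁾| ≤ W_k`.

Everything is PROVED; no definitions; nothing about the Hubbard model.  References: BGM 2006 §2.4 Lemma 2.1 (2.40)
[cite: BenfattoGiulianiMastropietro2006].
-/

noncomputable section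

namespace Summit.HubbardSuperconductivity.HubbardSuperconductivity.Theorems.PerturbedFermiCurve

set_option linter.dupNamespace false -- summit = problem name (single-conjunct summit), D-0017

open Real Set Finset
open Literature.MathematicalPhysics.QuantumLattice Literature.MathematicalPhysics.QuantumLattice.BandSectorCounting
open Summit.HubbardSuperconductivity.HubbardSuperconductivity.Theorems.DispersionFlow
open Summit.HubbardSuperconductivity.HubbardSuperconductivity.Theorems.KLRegimeSplit

/-! ## §1 The per-order size of `toLp ∘ (w • dir)` for any `C⁴` radius function -/

/-- **Per-order size of a polar curve map**: for `w ∈ C⁴` with `|w⁽ᵏ⁾(θ)| ≤ T k` (`k ≤ 4`) and `i ≤ 4`,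
`‖Dⁱ(θ ↦ toLp 2 (w θ • dir θ))(θ)‖ ≤ 2·Σ_{k ≤ i} C(i,k)·T k`. [folklore] -/
theorem norm_iteratedFDeriv_toLp_smul_dir_le {w : ℝ → ℝ} (hw : ContDiff ℝ 4 w) {θ : ℝ} {T : ℕ → ℝ}
    (hT : ∀ k ≤ 4, |iteratedDeriv k w θ| ≤ T k) {i : ℕ} (hi4 : i ≤ 4) :
    ‖iteratedFDeriv ℝ i (fun θ : ℝ => (WithLp.toLp 2 (w θ • dir θ) : Momentum)) θ‖ ≤ 2 * ∑ k ∈ range (i + 1), (i.choose k : ℝ) * T k := by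
  set Tl := ((EuclideanSpace.equiv (Fin 2) ℝ).symm : (Fin 2 → ℝ) →L[ℝ] Momentum) with hTl
  have hγ : (fun θ : ℝ => (WithLp.toLp 2 (w θ • dir θ) : Momentum)) = Tl ∘ fun θ => w θ • dir θ := by
    funext ϑ; simp [hTl]
  have hf4 : ContDiff ℝ 4 (fun θ => w θ • dir θ) := hw.smul contDiff_dir
  rw [hγ, Tl.iteratedFDeriv_comp_left hf4.contDiffAt (by exact_mod_cast hi4)]
  refine (Tl.norm_compContinuousMultilinearMap_le _).trans ?_
  have hw_k : ∀ k ≤ 4, ‖iteratedFDeriv ℝ k w θ‖ ≤ T k := by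
    intro k hk4
    rw [norm_iteratedFDeriv_eq_norm_iteratedDeriv, Real.norm_eq_abs]
    exact hT k hk4
  have hL := norm_iteratedFDeriv_smul_le (N := ((4 : ℕ) : WithTop ℕ∞)) hw contDiff_dir θ (n := i) (by exact_mod_cast hi4)
  have hterm : ∀ k ∈ range (i + 1), (i.choose k : ℝ) * ‖iteratedFDeriv ℝ k w θ‖ * ‖iteratedFDeriv ℝ (i - k) dir θ‖ ≤
      (i.choose k : ℝ) * T k := by
    intro k hk
    have hki : k ≤ i := Nat.lt_succ_iff.1 (mem_range.1 hk)
    have hT0 : 0 ≤ T k := (abs_nonneg _).trans (hT k (hki.trans hi4))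
    calc (i.choose k : ℝ) * ‖iteratedFDeriv ℝ k w θ‖ * ‖iteratedFDeriv ℝ (i - k) dir θ‖
        ≤ (i.choose k : ℝ) * T k * 1 :=
          mul_le_mul (mul_le_mul_of_nonneg_left (hw_k k (hki.trans hi4)) (by positivity)) (norm_iteratedFDeriv_dir_le _ _)
            (norm_nonneg _) (by positivity)
      _ = (i.choose k : ℝ) * T k := mul_one _
  have hS0 : 0 ≤ ∑ k ∈ range (i + 1), (i.choose k : ℝ) * T k := by
    refine sum_nonneg fun k hk => ?_
    have hki : k ≤ i := Nat.lt_succ_iff.1 (mem_range.1 hk)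
    have hT0 : 0 ≤ T k := (abs_nonneg _).trans (hT k (hki.trans hi4))
    positivity
  exact mul_le_mul norm_toLpCLM_le (hL.trans (sum_le_sum hterm)) (norm_nonneg _) (by norm_num)

/-- **The four orders spelled out** from a `deriv`-tower: `|w| ≤ T₀, …, |w⁗| ≤ T₄` at `θ` give
`‖D¹‖ ≤ 2(T₀+T₁)`, `‖D²‖ ≤ 2(T₀+2T₁+T₂)`, `‖D³‖ ≤ 2(T₀+3T₁+3T₂+T₃)`, `‖D⁴‖ ≤ 2(T₀+4T₁+6T₂+4T₃+T₄)`. [folklore] -/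
theorem norm_iteratedFDeriv_toLp_smul_dir_le_four_orders {w : ℝ → ℝ} (hw : ContDiff ℝ 4 w) {θ T₀ T₁ T₂ T₃ T₄ : ℝ}
    (h0 : |w θ| ≤ T₀) (h1 : |deriv w θ| ≤ T₁) (h2 : |deriv (deriv w) θ| ≤ T₂) (h3 : |deriv (deriv (deriv w)) θ| ≤ T₃)
    (h4 : |deriv (deriv (deriv (deriv w))) θ| ≤ T₄) :
    ‖iteratedFDeriv ℝ 1 (fun θ : ℝ => (WithLp.toLp 2 (w θ • dir θ) : Momentum)) θ‖ ≤ 2 * (T₀ + T₁) ∧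
    ‖iteratedFDeriv ℝ 2 (fun θ : ℝ => (WithLp.toLp 2 (w θ • dir θ) : Momentum)) θ‖ ≤ 2 * (T₀ + 2 * T₁ + T₂) ∧
    ‖iteratedFDeriv ℝ 3 (fun θ : ℝ => (WithLp.toLp 2 (w θ • dir θ) : Momentum)) θ‖ ≤ 2 * (T₀ + 3 * T₁ + 3 * T₂ + T₃) ∧
    ‖iteratedFDeriv ℝ 4 (fun θ : ℝ => (WithLp.toLp 2 (w θ • dir θ) : Momentum)) θ‖ ≤ 2 * (T₀ + 4 * T₁ + 6 * T₂ + 4 * T₃ + T₄) := by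
  have e1 : iteratedDeriv 1 w θ = deriv w θ := by rw [iteratedDeriv_one]
  have e2 : iteratedDeriv 2 w θ = deriv (deriv w) θ := by
    change iteratedDeriv (0 + 1 + 1) w θ = _
    rw [iteratedDeriv_succ, iteratedDeriv_succ, iteratedDeriv_zero]
  have e3 : iteratedDeriv 3 w θ = deriv (deriv (deriv w)) θ := by
    change iteratedDeriv (0 + 1 + 1 + 1) w θ = _
    rw [iteratedDeriv_succ, iteratedDeriv_succ, iteratedDeriv_succ, iteratedDeriv_zero]
  have e4 : iteratedDeriv 4 w θ = deriv (deriv (deriv (deriv w))) θ := by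
    change iteratedDeriv (0 + 1 + 1 + 1 + 1) w θ = _
    rw [iteratedDeriv_succ, iteratedDeriv_succ, iteratedDeriv_succ, iteratedDeriv_succ, iteratedDeriv_zero]
  set T : ℕ → ℝ := fun k => if k = 0 then T₀ else if k = 1 then T₁ else if k = 2 then T₂ else if k = 3 then T₃ else T₄ with hTdef
  have hT : ∀ k ≤ 4, |iteratedDeriv k w θ| ≤ T k := by
    intro k hk4
    interval_cases k
    · simpa [hTdef] using h0
    · rw [e1]; simpa [hTdef] using h1
    · rw [e2]; simpa [hTdef] using h2
    · rw [e3]; simpa [hTdef] using h3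
    · rw [e4]; simpa [hTdef] using h4
  have H := fun i (hi : i ≤ 4) => norm_iteratedFDeriv_toLp_smul_dir_le hw (θ := θ) hT hi
  refine ⟨(H 1 (by norm_num)).trans (le_of_eq ?_), (H 2 (by norm_num)).trans (le_of_eq ?_),
    (H 3 (by norm_num)).trans (le_of_eq ?_), (H 4 le_rfl).trans (le_of_eq ?_)⟩ <;>
    simp [hTdef, sum_range_succ, Nat.choose]

/-! ## §2 Two curves: linearity in the radius and the four difference bounds -/

/-- **Linearity in the radius**: `toLp (v θ • dir θ) − toLp (u θ • dir θ) = toLp ((v θ − u θ) • dir θ)`, as functions of `θ`. [folklore] -/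
theorem toLp_smul_dir_sub (u v : ℝ → ℝ) :
    (fun θ : ℝ => (WithLp.toLp 2 (v θ • dir θ) : Momentum)) - (fun θ : ℝ => (WithLp.toLp 2 (u θ • dir θ) : Momentum)) =
      fun θ : ℝ => (WithLp.toLp 2 ((v θ - u θ) • dir θ) : Momentum) := by
  funext θ
  simp only [Pi.sub_apply, sub_smul, WithLp.toLp_sub]

/-- **The curve differences, four orders**: for `C⁴` radius functions `u, v` with `|v − u| ≤ W₀`, `|v′ − u′| ≤ W₁`, `|v″ − u″| ≤ W₂`,
`|v‴ − u‴| ≤ W₃`, `|v⁗ − u⁗| ≤ W₄` at `θ` (`γ_w θ = toLp 2 (w θ • dir θ)`):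
`‖D¹γ_v(θ) − D¹γ_u(θ)‖ ≤ 2(W₀+W₁)`, `‖D²…‖ ≤ 2(W₀+2W₁+W₂)`, `‖D³…‖ ≤ 2(W₀+3W₁+3W₂+W₃)`, `‖D⁴…‖ ≤ 2(W₀+4W₁+6W₂+4W₃+W₄)`. [folklore] -/
theorem norm_iteratedFDeriv_curve_sub_le_four_orders {u v : ℝ → ℝ} (hu : ContDiff ℝ 4 u) (hv : ContDiff ℝ 4 v)
    {θ W₀ W₁ W₂ W₃ W₄ : ℝ} (h0 : |v θ - u θ| ≤ W₀) (h1 : |deriv v θ - deriv u θ| ≤ W₁)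
    (h2 : |deriv (deriv v) θ - deriv (deriv u) θ| ≤ W₂) (h3 : |deriv (deriv (deriv v)) θ - deriv (deriv (deriv u)) θ| ≤ W₃)
    (h4 : |deriv (deriv (deriv (deriv v))) θ - deriv (deriv (deriv (deriv u))) θ| ≤ W₄) :
    ‖iteratedFDeriv ℝ 1 (fun θ : ℝ => (WithLp.toLp 2 (v θ • dir θ) : Momentum)) θ -
        iteratedFDeriv ℝ 1 (fun θ : ℝ => (WithLp.toLp 2 (u θ • dir θ) : Momentum)) θ‖ ≤ 2 * (W₀ + W₁) ∧
    ‖iteratedFDeriv ℝ 2 (fun θ : ℝ => (WithLp.toLp 2 (v θ • dir θ) : Momentum)) θ -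
        iteratedFDeriv ℝ 2 (fun θ : ℝ => (WithLp.toLp 2 (u θ • dir θ) : Momentum)) θ‖ ≤ 2 * (W₀ + 2 * W₁ + W₂) ∧
    ‖iteratedFDeriv ℝ 3 (fun θ : ℝ => (WithLp.toLp 2 (v θ • dir θ) : Momentum)) θ -
        iteratedFDeriv ℝ 3 (fun θ : ℝ => (WithLp.toLp 2 (u θ • dir θ) : Momentum)) θ‖ ≤ 2 * (W₀ + 3 * W₁ + 3 * W₂ + W₃) ∧
    ‖iteratedFDeriv ℝ 4 (fun θ : ℝ => (WithLp.toLp 2 (v θ • dir θ) : Momentum)) θ -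
        iteratedFDeriv ℝ 4 (fun θ : ℝ => (WithLp.toLp 2 (u θ • dir θ) : Momentum)) θ‖ ≤
      2 * (W₀ + 4 * W₁ + 6 * W₂ + 4 * W₃ + W₄) := by
  have hw : ContDiff ℝ 4 (fun t => v t - u t) := hv.sub hu
  have hcv : ContDiff ℝ 4 (fun θ : ℝ => (WithLp.toLp 2 (v θ • dir θ) : Momentum)) :=
    (PiLp.contDiff_toLp.comp (hv.smul contDiff_dir) : _)
  have hcu : ContDiff ℝ 4 (fun θ : ℝ => (WithLp.toLp 2 (u θ • dir θ) : Momentum)) :=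
    (PiLp.contDiff_toLp.comp (hu.smul contDiff_dir) : _)
  have hsub : ∀ i ≤ 4, iteratedFDeriv ℝ i (fun θ : ℝ => (WithLp.toLp 2 (v θ • dir θ) : Momentum)) θ -
      iteratedFDeriv ℝ i (fun θ : ℝ => (WithLp.toLp 2 (u θ • dir θ) : Momentum)) θ =
      iteratedFDeriv ℝ i (fun θ : ℝ => (WithLp.toLp 2 ((v θ - u θ) • dir θ) : Momentum)) θ := by
    intro i hi
    rw [← toLp_smul_dir_sub, iteratedFDeriv_sub_apply (hcv.contDiffAt.of_le (by exact_mod_cast hi))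
      (hcu.contDiffAt.of_le (by exact_mod_cast hi))]
  -- derivatives of `v − u`
  have d1 : deriv (fun t => v t - u t) = fun t => deriv v t - deriv u t := by
    funext t
    exact deriv_sub ((hv.differentiable (by norm_num)) t) ((hu.differentiable (by norm_num)) t)
  have hv1 : ContDiff ℝ 3 (deriv v) := by
    have h := (contDiff_succ_iff_deriv.1 (show ContDiff ℝ ((3 : WithTop ℕ∞) + 1) v by norm_num; exact hv)).2.2; exact h
  have hu1 : ContDiff ℝ 3 (deriv u) := by
    have h := (contDiff_succ_iff_deriv.1 (show ContDiff ℝ ((3 : WithTop ℕ∞) + 1) u by norm_num; exact hu)).2.2; exact h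
  have d2 : deriv (deriv (fun t => v t - u t)) = fun t => deriv (deriv v) t - deriv (deriv u) t := by
    rw [d1]; funext t
    exact deriv_sub ((hv1.differentiable (by norm_num)) t) ((hu1.differentiable (by norm_num)) t)
  have hv2 : ContDiff ℝ 2 (deriv (deriv v)) := by
    have h := (contDiff_succ_iff_deriv.1 (show ContDiff ℝ ((2 : WithTop ℕ∞) + 1) (deriv v) by norm_num; exact hv1)).2.2; exact h
  have hu2 : ContDiff ℝ 2 (deriv (deriv u)) := by
    have h := (contDiff_succ_iff_deriv.1 (show ContDiff ℝ ((2 : WithTop ℕ∞) + 1) (deriv u) by norm_num; exact hu1)).2.2; exact h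
  have d3 : deriv (deriv (deriv (fun t => v t - u t))) = fun t => deriv (deriv (deriv v)) t - deriv (deriv (deriv u)) t := by
    rw [d2]; funext t
    exact deriv_sub ((hv2.differentiable (by norm_num)) t) ((hu2.differentiable (by norm_num)) t)
  have hv3 : ContDiff ℝ 1 (deriv (deriv (deriv v))) := by
    have h := (contDiff_succ_iff_deriv.1 (show ContDiff ℝ ((1 : WithTop ℕ∞) + 1) (deriv (deriv v)) by
      rw [one_add_one_eq_two]; exact hv2)).2.2; exact h
  have hu3 : ContDiff ℝ 1 (deriv (deriv (deriv u))) := by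
    have h := (contDiff_succ_iff_deriv.1 (show ContDiff ℝ ((1 : WithTop ℕ∞) + 1) (deriv (deriv u)) by
      rw [one_add_one_eq_two]; exact hu2)).2.2; exact h
  have d4 : deriv (deriv (deriv (deriv (fun t => v t - u t)))) θ =
      deriv (deriv (deriv (deriv v))) θ - deriv (deriv (deriv (deriv u))) θ := by
    rw [d3]
    exact deriv_sub ((hv3.differentiable one_ne_zero) θ) ((hu3.differentiable one_ne_zero) θ)
  have g1 : |deriv (fun t => v t - u t) θ| ≤ W₁ := by rw [d1]; exact h1
  have g2 : |deriv (deriv (fun t => v t - u t)) θ| ≤ W₂ := by rw [d2]; exact h2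
  have g3 : |deriv (deriv (deriv (fun t => v t - u t))) θ| ≤ W₃ := by rw [d3]; exact h3
  have g4 : |deriv (deriv (deriv (deriv (fun t => v t - u t)))) θ| ≤ W₄ := by rw [d4]; exact h4
  obtain ⟨b1, b2, b3, b4⟩ := norm_iteratedFDeriv_toLp_smul_dir_le_four_orders hw (θ := θ) h0 g1 g2 g3 g4
  rw [hsub 1 (by norm_num), hsub 2 (by norm_num), hsub 3 (by norm_num), hsub 4 le_rfl]
  exact ⟨b1, b2, b3, b4⟩

end Summit.HubbardSuperconductivity.HubbardSuperconductivity.Theorems.PerturbedFermiCurve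

end
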